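import Literature.NumberTheory.Rogawski1990.SingularSemisimpleElement
import Literature.NumberTheory.Rogawski1990.EndoscopicClassTransfer
import Literature.LinearAlgebra.Matrix.SplitSemisimpleConjClassClosed
import Literature.NumberTheory.Rogawski1990.KottwitzSteinbergRankTwo
import HarnessLib

/-!
# Singular semisimple classes of a unitary group in three variables: the eigenvalue pair of a non-regular semisimple element, and
# the stable classes of the endoscopic group `H = U(2) × U(1)` transferring to a singular class (Rogawski 1990, §3.8, §5.4)

Topic `NumberTheory/Rogawski1990`; namespace `Literature.NumberTheory.Rogawski1990`.  THEOREMS ONLY (no definition, no instance, no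
notation, no named fact, no `sorry`).  Cell `pub/hodgecm-mathlib`, ENGINE T1 (crux H413 = `stmt-HodgeConjecture-24833`), row O7 «singular semisimple
classes», piece «S-br + T-s» (A-p01 (g15) O7 OWNER WORD #8 (2); F0P5-p01 (g8)).  Sequel of ★ `SingularSemisimpleElement` (K1) and ★
`EndoscopicClassTransfer`; tools ★ `LinearAlgebra.Matrix.SplitSemisimpleConjClassClosed` (K6-ε ε1: split semisimple classes are charpoly fibres).

* §1 (S-br) **`exists_ne_mul_sub_eq_zero_of_isSemisimpleElt_of_not_isRegularElt`**: for `σ` an involution of a perfect field `K` with `2 ≠ 0`,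
  `H ∈ M₃(K)` hermitian non-degenerate, `γ ∈ U_σ(H)(K)` semisimple and NOT regular — with NO non-centrality hypothesis — there are `a ≠ b`
  of norm one (`σ(a) a = σ(b) b = 1`) with `(γ − a)(γ − b) = 0`; the non-central sharpening `…_charpoly_eq_…` adds `charpoly γ = (X − a)²(X − b)`
  (`a` the double eigenvalue), and `singular_semisimple_dichotomy` packages «central `ζ · 1` OR eigenvalues `{a, a, b}`» [Rogawski1990, §3.8
  Prop. 3.8.1 (a)].  Central companions: `norm_eq_one_of_coe_eq_smul_one` (`σ(ζ) ζ = 1`), `coe_eq_smul_one_of_isConj` (scalar classes are singletons).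
* §2 block plumbing for `ι(g₂, u) = reindex endoPerm (g₂ ⊕ u)` (★ `endoGL`): `(ι − a)(ι − b) = 0` and `ι = ζ · 1` read blockwise; norm-one scalars
  are unitary for every Gram matrix (`exists_unitary_coe_eq_smul_one`).
* §3 (T-s, any forms `J₂, J₁`, `h : endoForm J₂ J₁ = J₃`, target `U_σ(H′)`) for `γ₀ ∈ U_σ(H′)(K)` SINGULAR NON-CENTRAL, i.e. `(γ₀ − a)(γ₀ − b) = 0`,
  `charpoly γ₀ = (X − a)²(X − b)`, `a ≠ b` of norm one: the transfer criterion `endoMatches_iff_of_mul_sub_eq_zero` (★ `EndoMatches` ⟺ `ι(γ_H)`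
  killed by `(X − a)(X − b)` with the right charpoly); the matching pairs `(a · 1₂, b)` and `(h₂, a)` with `charpoly h₂ = (X − a)(X − b)`
  (`transfersTo_mk_of_fst_eq_smul_one`, `transfersTo_mk_of_charpoly_fst_eq`); EXHAUSTION: a transferring class (★ `StableClassH.TransfersTo`)
  has `U(1)`-component `sndVal ∈ {a, b}` (`StableClassH.TransfersTo.sndVal_eq_or_eq`) and is `[(a · 1₂, b)]` when `sndVal = b`
  (`….exists_rep_fst_eq_smul_one`, via ★ `eq_of_transfersTo_of_sndVal_eq`); the CENTRAL case `γ₀ = ζ · 1₃`: exactly the pair `(ζ · 1₂, ζ)`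
  matches (`transfersTo_mk_iff_of_coe_eq_smul_one`), so EXACTLY ONE class transfers (`ncard_∕natCard_…_eq_one_of_coe_eq_smul_one`).
* §4 (`J₂ = Φ₂ = antidiag(1,1)`, `2 ≠ 0`): the explicit `h₂ = ½ (a+b  a−b; a−b  a+b) ∈ U_σ(Φ₂)(K)` with `charpoly h₂ = (X − a)(X − b)`
  (`exists_unitary_antidiagTwo_charpoly_eq`), hence the class `[(h₂, a)]` transfers (`exists_transfersTo_sndVal_eq_double`), a transferring class
  with `sndVal = a` is it (`….exists_rep_sndVal_eq_double`), **EXACTLY TWO stable classes of `H` transfer to a singular non-central `𝒪_st(γ₀)`**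
  (`ncard_setOf_transfersTo_eq_two`, `natCard_subtype_transfersTo_eq_two`) and the structure theorem `transfersTo_iff_exists_rep`
  («`𝒪′_H ↦ 𝒪_st(γ₀)` iff `𝒪′_H = [(a · 1₂, b)]` or `[(h₂, a)]`») [Rogawski1990, §5.4 p. 78: the classes `{γ₀, γ₁, γ₂}` of a Cartan of type (1)
  transferring to `γ₀` — at a singular `γ₀` two of them coincide].
* §5 the CM reading (`σ = cmConjRingHom L`, `H = U(Φ₂) × U(Φ₁) → U(Φ₃)`, ★ `endoForm_antidiagOne`, target an arbitrary `H′ ∈ M₃(L)`).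

## References
* J. Rogawski, *Automorphic Representations of Unitary Groups in Three Variables*, Ann. of Math. Stud. 123 (1990): §3.8 «Singular semisimple
  elements», Prop. 3.8.1 p. 27; §3.1 p. 19; §5.4 Prop. 5.4.1 and p. 78 (the stable classes of `H` transferring to `γ₀`) [Rogawski1990].
* N. Jacobson, *Lectures in Abstract Algebra II*, Ch. IV §7 Thm. 5 (similarity of semisimple matrices by the characteristic polynomial) [Jacobson].
-/

set_option autoImplicit false

noncomputable section

namespace Literature.NumberTheory.Rogawski1990

open scoped MatrixGroups
open Matrix Polynomial
open Literature.AlgebraicGeometry.ShimuraVarieties (unitaryGroup hermForm)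
open Literature.NumberTheory.Automorphic.UnitaryGroup (finSum)

/-! ## §1 The eigenvalue pair `{a, b}` of a non-regular semisimple element (S-br) -/

section Spectral

variable {K : Type*} [Field K] (σ : K →+* K)

/-- A scalar element `ζ · 1` of `U_σ(H)(K)` with `H ≠ 0` has `σ(ζ) ζ = 1`. [cite: Rogawski1990, §3.1 p. 19] -/
theorem norm_eq_one_of_coe_eq_smul_one {n : Type*} [Fintype n] [DecidableEq n] {H : Matrix n n K} (hH0 : H ≠ 0)
    (γ : unitaryGroup σ H) {ζ : K} (hζ : ((γ : GL n K) : Matrix n n K) = ζ • (1 : Matrix n n K)) : σ ζ * ζ = 1 := by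
  have h := Literature.AlgebraicGeometry.ShimuraVarieties.mem_unitaryGroup_iff.mp γ.2
  have hmap : (ζ • (1 : Matrix n n K)).map σ = σ ζ • (1 : Matrix n n K) := by
    ext i j
    simp only [Matrix.map_apply, Matrix.smul_apply, Matrix.one_apply, smul_eq_mul, mul_ite, mul_one, mul_zero,
      apply_ite σ, map_zero]
  rw [hζ, hmap, Matrix.transpose_smul, Matrix.transpose_one, smul_mul_assoc, Matrix.one_mul, mul_smul_comm, Matrix.mul_one,
    smul_smul] at h
  -- `h : (ζ * σ ζ) • H = H`
  have h' : (ζ * σ ζ - 1) • H = 0 := by rw [sub_smul, one_smul, h, sub_self]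
  rcases smul_eq_zero.mp h' with h1 | h1
  · rw [mul_comm]; exact sub_eq_zero.mp h1
  · exact absurd h1 hH0

/-- A non-degenerate Gram matrix is non-zero. [folklore] -/
private theorem ne_zero_of_det_ne_zero {n : Type*} [Fintype n] [DecidableEq n] [Nonempty n] {H : Matrix n n K} (hdet : H.det ≠ 0) :
    H ≠ 0 := by
  rintro rfl
  exact hdet Matrix.det_zero

/-- The block-scalar matrix `a · 1₂ ⊕ᶠ b · 1₁` is the diagonal matrix `diag(a, a, b)`. [folklore] -/
private theorem finSum_smul_one_eq_diagonal (a b : K) :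
    finSum 2 1 (a • (1 : Matrix (Fin 2) (Fin 2) K)) (b • (1 : Matrix (Fin 1) (Fin 1) K)) = Matrix.diagonal ![a, a, b] := by
  rw [finSum, Matrix.smul_one_eq_diagonal, Matrix.smul_one_eq_diagonal, Matrix.fromBlocks_diagonal, Matrix.reindex_apply,
    Matrix.submatrix_diagonal_equiv]
  congr 1
  funext i
  fin_cases i <;> rfl

/-- `(diag(a,a,b) − a)(diag(a,a,b) − b) = 0`. [folklore] -/
private theorem diagonal_aab_mul_sub_eq_zero (a b : K) :
    (Matrix.diagonal ![a, a, b] - a • (1 : Matrix (Fin 3) (Fin 3) K)) * (Matrix.diagonal ![a, a, b] - b • (1 : Matrix (Fin 3) (Fin 3) K)) = 0 := by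
  ext i j
  fin_cases i <;> fin_cases j <;> simp [Matrix.mul_apply, Fin.sum_univ_three, Matrix.one_apply]

/-- `charpoly diag(a,a,b) = (X − a)² (X − b)`. [folklore] -/
private theorem charpoly_diagonal_aab (a b : K) :
    (Matrix.diagonal ![a, a, b]).charpoly = (X - C a) ^ 2 * (X - C b) := by
  rw [Matrix.charpoly_diagonal, Fin.prod_univ_three]
  simp only [Matrix.cons_val_zero, Matrix.cons_val_one, Matrix.cons_val_two, Matrix.head_cons, Matrix.tail_cons]
  ring

/-- From a frame `M P = P · diag(a,a,b)` (`P` invertible): `(M − a)(M − b) = 0` — the eigenvalues `{a, a, b}` of the frame.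
[cite: Rogawski1990, §3.8 Prop. 3.8.1 (a) p. 27] -/
theorem mul_sub_smul_one_eq_zero_of_mul_eq_mul_diagonal {M : Matrix (Fin 3) (Fin 3) K} (P : GL (Fin 3) K) {a b : K}
    (hMP : M * (P : Matrix (Fin 3) (Fin 3) K) = (P : Matrix (Fin 3) (Fin 3) K) * Matrix.diagonal ![a, a, b]) :
    (M - a • 1) * (M - b • 1) = 0 := by
  set D : Matrix (Fin 3) (Fin 3) K := Matrix.diagonal ![a, a, b] with hD
  have h1 : (M - a • 1) * (P : Matrix (Fin 3) (Fin 3) K) = (P : Matrix (Fin 3) (Fin 3) K) * (D - a • 1) := by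
    rw [Matrix.sub_mul, Matrix.mul_sub, hMP, smul_mul_assoc, Matrix.one_mul, mul_smul_comm, Matrix.mul_one]
  have h2 : (M - b • 1) * (P : Matrix (Fin 3) (Fin 3) K) = (P : Matrix (Fin 3) (Fin 3) K) * (D - b • 1) := by
    rw [Matrix.sub_mul, Matrix.mul_sub, hMP, smul_mul_assoc, Matrix.one_mul, mul_smul_comm, Matrix.mul_one]
  have h3 : (M - a • 1) * (M - b • 1) * (P : Matrix (Fin 3) (Fin 3) K) = 0 := by
    rw [Matrix.mul_assoc, h2, ← Matrix.mul_assoc, h1, Matrix.mul_assoc, hD, diagonal_aab_mul_sub_eq_zero, Matrix.mul_zero]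
  calc (M - a • 1) * (M - b • 1)
      = (M - a • 1) * (M - b • 1) * (P : Matrix (Fin 3) (Fin 3) K) * (P : Matrix (Fin 3) (Fin 3) K)⁻¹ := by
        rw [Matrix.mul_nonsing_inv_cancel_right _ _ (Matrix.isUnits_det_units P)]
    _ = 0 := by rw [h3, Matrix.zero_mul]

/-- From a frame `M P = P · diag(a,a,b)` (`P` invertible): `charpoly M = (X − a)² (X − b)`. [cite: Rogawski1990, §3.8 Prop. 3.8.1 (a) p. 27] -/
theorem charpoly_eq_of_mul_eq_mul_diagonal {M : Matrix (Fin 3) (Fin 3) K} (P : GL (Fin 3) K) {a b : K}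
    (hMP : M * (P : Matrix (Fin 3) (Fin 3) K) = (P : Matrix (Fin 3) (Fin 3) K) * Matrix.diagonal ![a, a, b]) :
    M.charpoly = (X - C a) ^ 2 * (X - C b) := by
  have hMc : M = (P : Matrix (Fin 3) (Fin 3) K) * Matrix.diagonal ![a, a, b] * ((P⁻¹ : GL (Fin 3) K) : Matrix (Fin 3) (Fin 3) K) := by
    rw [← hMP, Matrix.mul_assoc, ← Units.val_mul, mul_inv_cancel, Units.val_one, Matrix.mul_one]
  rw [hMc, Matrix.coe_units_inv, Matrix.charpoly_units_conj, charpoly_diagonal_aab]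

variable [PerfectField K]

/-- **(S-br) The eigenvalue pair of a SINGULAR semisimple element**: for `σ` an involution, `(2 : K) ≠ 0`, `H ∈ M₃(K)` hermitian
non-degenerate and `γ ∈ U_σ(H)(K)` semisimple (★ `IsSemisimpleElt`) and NOT regular (¬ ★ `IsRegularElt`), there are `a ≠ b` in `K` of
norm one (`σ(a) a = σ(b) b = 1`) with `(γ − a)(γ − b) = 0` — NO non-centrality hypothesis: a non-central `γ` has eigenvalues `{a, a, b}`
(★ `exists_singular_frame_of_isSemisimpleElt`), a central `γ = ζ · 1` takes `(a, b) = (ζ, −ζ)`.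
[cite: Rogawski1990, §3.8 Prop. 3.8.1 (a) p. 27; §3.1 p. 19] -/
theorem exists_ne_mul_sub_eq_zero_of_isSemisimpleElt_of_not_isRegularElt (hσ : ∀ x, σ (σ x) = x) (h2 : (2 : K) ≠ 0)
    {H : Matrix (Fin 3) (Fin 3) K} (hH : (H.map σ)ᵀ = H) (hdet : H.det ≠ 0)
    (γ : unitaryGroup σ H) (hss : IsSemisimpleElt σ H γ) (hnreg : ¬ IsRegularElt (γ : GL (Fin 3) K)) :
    ∃ a b : K, a ≠ b ∧ σ a * a = 1 ∧ σ b * b = 1 ∧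
      (((γ : GL (Fin 3) K) : Matrix (Fin 3) (Fin 3) K) - a • 1) * (((γ : GL (Fin 3) K) : Matrix (Fin 3) (Fin 3) K) - b • 1) = 0 := by
  by_cases hsc : ∃ ζ : K, ((γ : GL (Fin 3) K) : Matrix (Fin 3) (Fin 3) K) = ζ • 1
  · obtain ⟨ζ, hζ⟩ := hsc
    have hn : σ ζ * ζ = 1 := norm_eq_one_of_coe_eq_smul_one σ (ne_zero_of_det_ne_zero hdet) γ hζ
    refine ⟨ζ, -ζ, ?_, hn, by rw [map_neg, neg_mul_neg, hn], by rw [hζ, sub_self, Matrix.zero_mul]⟩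
    intro h
    have hζ0 : ζ = 0 := by
      have h2ζ : (2 : K) * ζ = 0 := by linear_combination h
      rcases mul_eq_zero.mp h2ζ with h0 | h0
      · exact absurd h0 h2
      · exact h0
    rw [hζ0, mul_zero] at hn
    exact zero_ne_one hn
  · push Not at hsc
    obtain ⟨a, b, P, Ha, Hb, hab, haa, hbb, -, hγP, -, -, -, -⟩ :=
      exists_singular_frame_of_isSemisimpleElt σ hσ H hH hdet γ hss hnreg hsc
    rw [finSum_smul_one_eq_diagonal] at hγP
    exact ⟨a, b, hab, haa, hbb, mul_sub_smul_one_eq_zero_of_mul_eq_mul_diagonal P hγP⟩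


/-- **(S-br, non-central sharpening) eigenvalues `{a, a, b}`**: for `γ` semisimple, not regular and NOT a scalar, the pair of (S-br) can be
chosen with `a` the DOUBLE eigenvalue: `charpoly γ = (X − a)² (X − b)` (from the frame `γ P = P (a·1₂ ⊕ᶠ b·1₁)` of ★
`exists_singular_frame_of_isSemisimpleElt`). [cite: Rogawski1990, §3.8 Prop. 3.8.1 (a) p. 27] -/
theorem exists_ne_mul_sub_eq_zero_charpoly_eq_of_isSemisimpleElt (hσ : ∀ x, σ (σ x) = x)
    {H : Matrix (Fin 3) (Fin 3) K} (hH : (H.map σ)ᵀ = H) (hdet : H.det ≠ 0)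
    (γ : unitaryGroup σ H) (hss : IsSemisimpleElt σ H γ) (hnreg : ¬ IsRegularElt (γ : GL (Fin 3) K))
    (hnsc : ∀ ζ : K, ((γ : GL (Fin 3) K) : Matrix (Fin 3) (Fin 3) K) ≠ ζ • 1) :
    ∃ a b : K, a ≠ b ∧ σ a * a = 1 ∧ σ b * b = 1 ∧
      (((γ : GL (Fin 3) K) : Matrix (Fin 3) (Fin 3) K) - a • 1) * (((γ : GL (Fin 3) K) : Matrix (Fin 3) (Fin 3) K) - b • 1) = 0 ∧
      ((γ : GL (Fin 3) K) : Matrix (Fin 3) (Fin 3) K).charpoly = (X - C a) ^ 2 * (X - C b) := by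
  obtain ⟨a, b, P, Ha, Hb, hab, haa, hbb, -, hγP, -, -, -, -⟩ :=
    exists_singular_frame_of_isSemisimpleElt σ hσ H hH hdet γ hss hnreg hnsc
  rw [finSum_smul_one_eq_diagonal] at hγP
  exact ⟨a, b, hab, haa, hbb, mul_sub_smul_one_eq_zero_of_mul_eq_mul_diagonal P hγP, charpoly_eq_of_mul_eq_mul_diagonal P hγP⟩

/-- **Dichotomy for singular semisimple elements**: a non-regular semisimple `γ ∈ U_σ(H)(K)` is either CENTRAL (`γ = ζ · 1`, `σ(ζ) ζ = 1`) or
has eigenvalues `{a, a, b}` with `a ≠ b` of norm one, `(γ − a)(γ − b) = 0`, `charpoly γ = (X − a)²(X − b)`.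
[cite: Rogawski1990, §3.8 Prop. 3.8.1 (a) p. 27; §3.1 p. 19] -/
theorem singular_semisimple_dichotomy (hσ : ∀ x, σ (σ x) = x)
    {H : Matrix (Fin 3) (Fin 3) K} (hH : (H.map σ)ᵀ = H) (hdet : H.det ≠ 0)
    (γ : unitaryGroup σ H) (hss : IsSemisimpleElt σ H γ) (hnreg : ¬ IsRegularElt (γ : GL (Fin 3) K)) :
    (∃ ζ : K, σ ζ * ζ = 1 ∧ ((γ : GL (Fin 3) K) : Matrix (Fin 3) (Fin 3) K) = ζ • 1) ∨
    (∃ a b : K, a ≠ b ∧ σ a * a = 1 ∧ σ b * b = 1 ∧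
      (((γ : GL (Fin 3) K) : Matrix (Fin 3) (Fin 3) K) - a • 1) * (((γ : GL (Fin 3) K) : Matrix (Fin 3) (Fin 3) K) - b • 1) = 0 ∧
      ((γ : GL (Fin 3) K) : Matrix (Fin 3) (Fin 3) K).charpoly = (X - C a) ^ 2 * (X - C b)) := by
  by_cases hsc : ∃ ζ : K, ((γ : GL (Fin 3) K) : Matrix (Fin 3) (Fin 3) K) = ζ • 1
  · obtain ⟨ζ, hζ⟩ := hsc
    exact Or.inl ⟨ζ, norm_eq_one_of_coe_eq_smul_one σ (ne_zero_of_det_ne_zero hdet) γ hζ, hζ⟩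
  · push Not at hsc
    exact Or.inr (exists_ne_mul_sub_eq_zero_charpoly_eq_of_isSemisimpleElt σ hσ hH hdet γ hss hnreg hsc)


end Spectral
/-! ## §2 Block lemmas for the endoscopic embedding `ι(g₂, u) = (g₂ 0; 0 u)` up to `endoPerm` -/

section Blocks

variable {K : Type*} [Field K]

/-- `ι(g₂, u) − c · 1 = ι(g₂ − c · 1, u − c · 1)` (blockwise). [folklore] -/
private theorem reindex_fromBlocks_sub_smul_one (g₂ : Matrix (Fin 2) (Fin 2) K) (u : Matrix (Fin 1) (Fin 1) K) (c : K) :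
    Matrix.reindex endoPerm endoPerm (Matrix.fromBlocks g₂ 0 0 u) - c • (1 : Matrix (Fin 3) (Fin 3) K) =
      Matrix.reindex endoPerm endoPerm (Matrix.fromBlocks (g₂ - c • 1) 0 0 (u - c • 1)) := by
  ext i j
  fin_cases i <;> fin_cases j <;>
    simp [Matrix.submatrix_apply, Matrix.fromBlocks_apply₁₁, Matrix.fromBlocks_apply₁₂, Matrix.fromBlocks_apply₂₁,
      Matrix.fromBlocks_apply₂₂]

/-- `ι(A, B) · ι(A′, B′) = ι(A A′, B B′)`. [folklore] -/
private theorem reindex_fromBlocks_mul (A A' : Matrix (Fin 2) (Fin 2) K) (B B' : Matrix (Fin 1) (Fin 1) K) :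
    Matrix.reindex endoPerm endoPerm (Matrix.fromBlocks A 0 0 B) * Matrix.reindex endoPerm endoPerm (Matrix.fromBlocks A' 0 0 B') =
      Matrix.reindex endoPerm endoPerm (Matrix.fromBlocks (A * A') 0 0 (B * B')) := by
  rw [Matrix.reindex_apply, Matrix.reindex_apply, Matrix.reindex_apply, Matrix.submatrix_mul_equiv, Matrix.fromBlocks_multiply]
  simp

/-- `ι(A, B) = 0 ↔ A = 0 ∧ B = 0`. [folklore] -/
private theorem reindex_fromBlocks_eq_zero_iff (A : Matrix (Fin 2) (Fin 2) K) (B : Matrix (Fin 1) (Fin 1) K) :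
    Matrix.reindex endoPerm endoPerm (Matrix.fromBlocks A 0 0 B) = 0 ↔ A = 0 ∧ B = 0 := by
  constructor
  · intro h
    have h' : Matrix.fromBlocks A 0 0 B = Matrix.fromBlocks 0 0 0 0 := by
      rw [Matrix.fromBlocks_zero]
      apply (Matrix.reindex endoPerm endoPerm).injective
      rw [h, Matrix.reindex_apply, Matrix.submatrix_zero, Pi.zero_def, Pi.zero_def]
    obtain ⟨hA, -, -, hB⟩ := Matrix.fromBlocks_inj.mp h'
    exact ⟨hA, hB⟩
  · rintro ⟨rfl, rfl⟩
    rw [Matrix.fromBlocks_zero, Matrix.reindex_apply, Matrix.submatrix_zero, Pi.zero_def, Pi.zero_def]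

/-- `(ι(g₂, u) − a)(ι(g₂, u) − b) = 0 ↔ (g₂ − a)(g₂ − b) = 0 ∧ (u − a)(u − b) = 0` — the embedding `ι` (★ `endoGL`, the matrix
`(* 0 *; 0 u 0; * 0 *)`) read blockwise. [cite: Rogawski1990, §4.8 Case (a) p. 53] -/
theorem endoGL_mul_sub_smul_one_eq_zero_iff (g : GL (Fin 2) K × GL (Fin 1) K) (a b : K) :
    (((endoGL g : GL (Fin 3) K) : Matrix (Fin 3) (Fin 3) K) - a • 1) * (((endoGL g : GL (Fin 3) K) : Matrix (Fin 3) (Fin 3) K) - b • 1) = 0 ↔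
      ((g.1 : Matrix (Fin 2) (Fin 2) K) - a • 1) * ((g.1 : Matrix (Fin 2) (Fin 2) K) - b • 1) = 0 ∧
        ((g.2 : Matrix (Fin 1) (Fin 1) K) - a • 1) * ((g.2 : Matrix (Fin 1) (Fin 1) K) - b • 1) = 0 := by
  rw [coe_endoGL, reindex_fromBlocks_sub_smul_one, reindex_fromBlocks_sub_smul_one, reindex_fromBlocks_mul, reindex_fromBlocks_eq_zero_iff]

/-- `ι(g₂, u) = ζ · 1 ↔ g₂ = ζ · 1 ∧ u = ζ · 1` (★ `endoGL` read blockwise). [cite: Rogawski1990, §4.8 Case (a) p. 53] -/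
theorem endoGL_eq_smul_one_iff (g : GL (Fin 2) K × GL (Fin 1) K) (ζ : K) :
    ((endoGL g : GL (Fin 3) K) : Matrix (Fin 3) (Fin 3) K) = ζ • 1 ↔
      (g.1 : Matrix (Fin 2) (Fin 2) K) = ζ • 1 ∧ (g.2 : Matrix (Fin 1) (Fin 1) K) = ζ • 1 := by
  rw [← sub_eq_zero, coe_endoGL, reindex_fromBlocks_sub_smul_one, reindex_fromBlocks_eq_zero_iff, sub_eq_zero, sub_eq_zero]

/-- Cayley–Hamilton at a split quadratic: `charpoly M = (X − a)(X − b) ⇒ (M − a)(M − b) = 0`. [folklore] -/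
private theorem mul_sub_smul_one_eq_zero_of_charpoly_eq {n : Type*} [Fintype n] [DecidableEq n] (M : Matrix n n K) {a b : K}
    (hM : M.charpoly = (X - C a) * (X - C b)) : (M - a • 1) * (M - b • 1) = 0 := by
  have hCH := Matrix.aeval_self_charpoly M
  rw [hM, map_mul, map_sub, map_sub, Polynomial.aeval_X, Polynomial.aeval_C, Polynomial.aeval_C, Algebra.algebraMap_eq_smul_one,
    Algebra.algebraMap_eq_smul_one] at hCH
  exact hCH

/-- `GL_n(K)`-conjugation (stable conjugacy, ★ `IsStablyConj` ∕ `Corresponds`) transports `(x − a)(x − b) = 0`. [cite: Rogawski1990, §3.1 p. 19] -/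
theorem mul_sub_smul_one_eq_zero_of_isConj {n : Type*} [Fintype n] [DecidableEq n] {x y : GL n K} (h : IsConj x y) {a b : K}
    (hx : ((x : Matrix n n K) - a • 1) * ((x : Matrix n n K) - b • 1) = 0) :
    ((y : Matrix n n K) - a • 1) * ((y : Matrix n n K) - b • 1) = 0 := by
  obtain ⟨c, hc⟩ := isConj_iff.mp h
  have hy : (y : Matrix n n K) = (c : Matrix n n K) * x * ((c⁻¹ : GL n K) : Matrix n n K) := by
    rw [← hc, Units.val_mul, Units.val_mul]
  have hcc : (c : Matrix n n K) * ((c⁻¹ : GL n K) : Matrix n n K) = 1 := by rw [← Units.val_mul, mul_inv_cancel, Units.val_one]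
  have hcc' : ((c⁻¹ : GL n K) : Matrix n n K) * (c : Matrix n n K) = 1 := by rw [← Units.val_mul, inv_mul_cancel, Units.val_one]
  have h1 : ∀ t : K, (y : Matrix n n K) - t • 1 = (c : Matrix n n K) * ((x : Matrix n n K) - t • 1) * ((c⁻¹ : GL n K) : Matrix n n K) := by
    intro t
    rw [Matrix.mul_sub, Matrix.sub_mul, ← hy, mul_smul_comm, Matrix.mul_one, smul_mul_assoc, hcc]
  calc ((y : Matrix n n K) - a • 1) * ((y : Matrix n n K) - b • 1)
      = (c : Matrix n n K) * (((x : Matrix n n K) - a • 1) * (((c⁻¹ : GL n K) : Matrix n n K) * (c : Matrix n n K)) *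
          ((x : Matrix n n K) - b • 1)) * ((c⁻¹ : GL n K) : Matrix n n K) := by
        rw [h1 a, h1 b]; simp only [Matrix.mul_assoc]
    _ = 0 := by rw [hcc', Matrix.mul_one, hx, Matrix.mul_zero, Matrix.zero_mul]

/-- **Scalar classes are singletons**: `x = ζ · 1`, `x ∼ y` in `GL_n(K)` ⇒ `y = ζ · 1` (so a stable class ∕ correspondence class of a
central element is a point). [cite: Rogawski1990, §3.1 p. 19] -/
theorem coe_eq_smul_one_of_isConj {n : Type*} [Fintype n] [DecidableEq n] {x y : GL n K} (h : IsConj x y) {ζ : K}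
    (hx : (x : Matrix n n K) = ζ • 1) : (y : Matrix n n K) = ζ • 1 := by
  obtain ⟨c, hc⟩ := isConj_iff.mp h
  rw [← hc, Units.val_mul, Units.val_mul, hx, mul_smul_comm, Matrix.mul_one, smul_mul_assoc, ← Units.val_mul, mul_inv_cancel,
    Units.val_one]

/-- **Norm-one scalars are unitary**: for `σ(a) a = 1` and ANY Gram matrix `J`, `a · 1 ∈ U_σ(J)(K)`. [cite: Rogawski1990, §3.1 p. 19] -/
theorem exists_unitary_coe_eq_smul_one {n : Type*} [Fintype n] [DecidableEq n] (σ : K →+* K) (J : Matrix n n K) {a : K}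
    (ha : σ a * a = 1) : ∃ g : unitaryGroup σ J, ((g : GL n K) : Matrix n n K) = a • 1 := by
  have ha0 : a ≠ 0 := fun h => by rw [h, mul_zero] at ha; exact zero_ne_one ha
  have hu : IsUnit (a • (1 : Matrix n n K)) :=
    (Matrix.isUnit_iff_isUnit_det _).mpr (by rw [Matrix.det_smul, Matrix.det_one, mul_one]; exact (isUnit_iff_ne_zero.mpr ha0).pow _)
  refine ⟨⟨hu.unit, Literature.AlgebraicGeometry.ShimuraVarieties.mem_unitaryGroup_iff.mpr ?_⟩, hu.unit_spec⟩
  have hmap : (a • (1 : Matrix n n K)).map σ = σ a • (1 : Matrix n n K) := by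
    ext i j
    simp only [Matrix.map_apply, Matrix.smul_apply, Matrix.one_apply, smul_eq_mul, mul_ite, mul_one, mul_zero, apply_ite σ, map_zero]
  rw [hu.unit_spec, hmap, Matrix.transpose_smul, Matrix.transpose_one, smul_mul_assoc, Matrix.one_mul, mul_smul_comm, Matrix.mul_one,
    smul_smul, mul_comm a (σ a), ha, one_smul]

end Blocks

/-! ## §3 The stable classes of `H = U(J₂) × U(J₁)` transferring to a SINGULAR class `{a, a, b}` of `U(H′)` (T-s) -/

section Transfer

variable {K : Type*} [Field K] (σ : K →+* K) {J₂ : Matrix (Fin 2) (Fin 2) K} {J₁ : Matrix (Fin 1) (Fin 1) K}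
  {J₃ : Matrix (Fin 3) (Fin 3) K} (h : endoForm J₂ J₁ = J₃) {H' : Matrix (Fin 3) (Fin 3) K}

/-- **Transfer criterion at a split semisimple class**: if `(γ₀ − a)(γ₀ − b) = 0` with `a ≠ b`, then `γ_H = (g₂, u)` matches `γ₀`
(★ `EndoMatches`: `ι(γ_H)` is `GL₃(K)`-conjugate to `γ₀`) iff `ι(γ_H)` is killed by `(X − a)(X − b)` and has the characteristic polynomial of
`γ₀` (★ `exists_units_conj_eq_of_mul_sub_eq_zero_field`: split semisimple classes are charpoly fibres). [cite: Rogawski1990, §3.8 p. 27; §5.4 p. 78] -/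
theorem endoMatches_iff_of_mul_sub_eq_zero (γH : unitaryGroup σ J₂ × unitaryGroup σ J₁) (γ₀ : unitaryGroup σ H') {a b : K} (hab : a ≠ b)
    (hγ : (((γ₀ : GL (Fin 3) K) : Matrix (Fin 3) (Fin 3) K) - a • 1) * (((γ₀ : GL (Fin 3) K) : Matrix (Fin 3) (Fin 3) K) - b • 1) = 0) :
    EndoMatches σ J₂ J₁ J₃ H' h γH γ₀ ↔
      ((((γH.1 : GL (Fin 2) K) : Matrix (Fin 2) (Fin 2) K) - a • 1) * (((γH.1 : GL (Fin 2) K) : Matrix (Fin 2) (Fin 2) K) - b • 1) = 0 ∧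
        (((γH.2 : GL (Fin 1) K) : Matrix (Fin 1) (Fin 1) K) - a • 1) * (((γH.2 : GL (Fin 1) K) : Matrix (Fin 1) (Fin 1) K) - b • 1) = 0) ∧
      ((γH.1 : GL (Fin 2) K) : Matrix (Fin 2) (Fin 2) K).charpoly * ((γH.2 : GL (Fin 1) K) : Matrix (Fin 1) (Fin 1) K).charpoly =
          ((γ₀ : GL (Fin 3) K) : Matrix (Fin 3) (Fin 3) K).charpoly := by
  unfold EndoMatches Corresponds
  have e1 := charpoly_endoGL ((γH.1 : GL (Fin 2) K), (γH.2 : GL (Fin 1) K))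
  have e2 := endoGL_mul_sub_smul_one_eq_zero_iff ((γH.1 : GL (Fin 2) K), (γH.2 : GL (Fin 1) K)) a b
  dsimp only at e1 e2
  rw [coe_endoEmb, ← e1, ← e2]
  constructor
  · intro hc
    exact ⟨mul_sub_smul_one_eq_zero_of_isConj hc.symm hγ, by
      obtain ⟨c, hc'⟩ := isConj_iff.mp hc
      rw [← hc', Units.val_mul, Units.val_mul, Matrix.coe_units_inv, Matrix.charpoly_units_conj]⟩
  · rintro ⟨hE, hchar⟩
    obtain ⟨g, hg⟩ := Literature.LinearAlgebra.Matrix.exists_units_conj_eq_of_mul_sub_eq_zero_field _ _ hab hE hγ hchar.symm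
    exact isConj_iff.mpr ⟨g, hg⟩

/-- **The pair `(a · 1₂, b)` matches** a `γ₀` with `(γ₀ − a)(γ₀ − b) = 0`, `charpoly γ₀ = (X − a)²(X − b)`, `a ≠ b` (`ι = diag(a, b, a)`; any `J₂, J₁`).
[cite: Rogawski1990, §5.4 p. 78; §3.8 Prop. 3.8.1 p. 27] -/
theorem transfersTo_mk_of_fst_eq_smul_one {γ₀ : unitaryGroup σ H'} {a b : K} (hab : a ≠ b)
    (hγ : (((γ₀ : GL (Fin 3) K) : Matrix (Fin 3) (Fin 3) K) - a • 1) * (((γ₀ : GL (Fin 3) K) : Matrix (Fin 3) (Fin 3) K) - b • 1) = 0)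
    (hchar : ((γ₀ : GL (Fin 3) K) : Matrix (Fin 3) (Fin 3) K).charpoly = (X - C a) ^ 2 * (X - C b))
    (γH : unitaryGroup σ J₂ × unitaryGroup σ J₁) (h1 : ((γH.1 : GL (Fin 2) K) : Matrix (Fin 2) (Fin 2) K) = a • 1)
    (h2 : ((γH.2 : GL (Fin 1) K) : Matrix (Fin 1) (Fin 1) K) = b • 1) :
    (stableClassHOf σ J₂ J₁ γH).TransfersTo H' h (stableClassOf σ H' γ₀) := by
  rw [StableClassH.transfersTo_mk_iff, endoMatches_iff_of_mul_sub_eq_zero σ h _ γ₀ hab hγ, hchar, h1, h2]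
  refine ⟨⟨by rw [sub_self, Matrix.zero_mul], by rw [sub_self, Matrix.mul_zero]⟩, ?_⟩
  rw [Matrix.smul_one_eq_diagonal, Matrix.smul_one_eq_diagonal, Matrix.charpoly_diagonal, Matrix.charpoly_diagonal, Fin.prod_univ_two,
    Fin.prod_univ_one]
  ring

/-- **The pair `(h₂, a)` with `charpoly h₂ = (X − a)(X − b)` matches** the same `γ₀` (`ι ∼ diag(a, b, a)`; any `J₂, J₁`; `(h₂ − a)(h₂ − b) = 0` is
Cayley–Hamilton). [cite: Rogawski1990, §5.4 p. 78; §3.8 Prop. 3.8.1 p. 27] -/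
theorem transfersTo_mk_of_charpoly_fst_eq {γ₀ : unitaryGroup σ H'} {a b : K} (hab : a ≠ b)
    (hγ : (((γ₀ : GL (Fin 3) K) : Matrix (Fin 3) (Fin 3) K) - a • 1) * (((γ₀ : GL (Fin 3) K) : Matrix (Fin 3) (Fin 3) K) - b • 1) = 0)
    (hchar : ((γ₀ : GL (Fin 3) K) : Matrix (Fin 3) (Fin 3) K).charpoly = (X - C a) ^ 2 * (X - C b))
    (γH : unitaryGroup σ J₂ × unitaryGroup σ J₁) (h1 : ((γH.1 : GL (Fin 2) K) : Matrix (Fin 2) (Fin 2) K).charpoly = (X - C a) * (X - C b))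
    (h2 : ((γH.2 : GL (Fin 1) K) : Matrix (Fin 1) (Fin 1) K) = a • 1) :
    (stableClassHOf σ J₂ J₁ γH).TransfersTo H' h (stableClassOf σ H' γ₀) := by
  rw [StableClassH.transfersTo_mk_iff, endoMatches_iff_of_mul_sub_eq_zero σ h _ γ₀ hab hγ, hchar, h1, h2]
  refine ⟨⟨mul_sub_smul_one_eq_zero_of_charpoly_eq _ h1, by rw [sub_self, Matrix.zero_mul]⟩, ?_⟩
  rw [Matrix.smul_one_eq_diagonal, Matrix.charpoly_diagonal, Fin.prod_univ_one]
  ring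

/-- **Exhaustion, part 1: the `U(1)`-component of a transferring class is an eigenvalue.**  If `charpoly γ₀ = (X − a)²(X − b)` and `𝒪′_H ↦ 𝒪_st(γ₀)`,
then `sndVal 𝒪′_H ∈ {a, b}` (★ `TransfersTo.isRoot_sndVal`). [cite: Rogawski1990, §5.4 p. 78] -/
theorem StableClassH.TransfersTo.sndVal_eq_or_eq {γ₀ : unitaryGroup σ H'} {a b : K}
    (hchar : ((γ₀ : GL (Fin 3) K) : Matrix (Fin 3) (Fin 3) K).charpoly = (X - C a) ^ 2 * (X - C b))
    {𝒪 : StableClassH σ J₂ J₁} (ht : 𝒪.TransfersTo H' h (stableClassOf σ H' γ₀)) : 𝒪.sndVal = a ∨ 𝒪.sndVal = b := by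
  have hr := ht.isRoot_sndVal
  rw [StableClass.charpoly_stableClassOf, hchar, Polynomial.IsRoot, eval_mul, eval_pow, eval_sub, eval_sub, eval_X, eval_C, eval_C,
    mul_eq_zero] at hr
  rcases hr with hr | hr
  · exact Or.inl (sub_eq_zero.mp (pow_eq_zero_iff two_ne_zero |>.mp hr))
  · exact Or.inr (sub_eq_zero.mp hr)

/-- **Existence, the class `[(a · 1₂, b)]`** (any `J₂, J₁`; `a, b` of norm one). [cite: Rogawski1990, §5.4 p. 78] -/
theorem exists_transfersTo_fst_eq_smul_one (γ₀ : unitaryGroup σ H') {a b : K} (hab : a ≠ b) (ha : σ a * a = 1) (hb : σ b * b = 1)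
    (hγ : (((γ₀ : GL (Fin 3) K) : Matrix (Fin 3) (Fin 3) K) - a • 1) * (((γ₀ : GL (Fin 3) K) : Matrix (Fin 3) (Fin 3) K) - b • 1) = 0)
    (hchar : ((γ₀ : GL (Fin 3) K) : Matrix (Fin 3) (Fin 3) K).charpoly = (X - C a) ^ 2 * (X - C b)) :
    ∃ γH : unitaryGroup σ J₂ × unitaryGroup σ J₁,
      ((γH.1 : GL (Fin 2) K) : Matrix (Fin 2) (Fin 2) K) = a • 1 ∧ ((γH.2 : GL (Fin 1) K) : Matrix (Fin 1) (Fin 1) K) = b • 1 ∧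
        (stableClassHOf σ J₂ J₁ γH).TransfersTo H' h (stableClassOf σ H' γ₀) := by
  obtain ⟨g₂, hg₂⟩ := exists_unitary_coe_eq_smul_one σ J₂ ha
  obtain ⟨u, hu⟩ := exists_unitary_coe_eq_smul_one σ J₁ hb
  exact ⟨(g₂, u), hg₂, hu, transfersTo_mk_of_fst_eq_smul_one σ h hab hγ hchar _ hg₂ hu⟩

/-- **Exhaustion, part 3: a transferring class with `sndVal = b` IS `[(a · 1₂, b)]`** (uniqueness per `U(1)`-value is ★ `eq_of_transfersTo_of_sndVal_eq`).
[cite: Rogawski1990, §5.4 p. 78] -/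
theorem StableClassH.TransfersTo.exists_rep_fst_eq_smul_one [Infinite K] {γ₀ : unitaryGroup σ H'} {a b : K} (hab : a ≠ b) (ha : σ a * a = 1)
    (hb : σ b * b = 1)
    (hγ : (((γ₀ : GL (Fin 3) K) : Matrix (Fin 3) (Fin 3) K) - a • 1) * (((γ₀ : GL (Fin 3) K) : Matrix (Fin 3) (Fin 3) K) - b • 1) = 0)
    (hchar : ((γ₀ : GL (Fin 3) K) : Matrix (Fin 3) (Fin 3) K).charpoly = (X - C a) ^ 2 * (X - C b))
    {𝒪 : StableClassH σ J₂ J₁} (ht : 𝒪.TransfersTo H' h (stableClassOf σ H' γ₀)) (hsnd : 𝒪.sndVal = b) :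
    ∃ γH : unitaryGroup σ J₂ × unitaryGroup σ J₁, stableClassHOf σ J₂ J₁ γH = 𝒪 ∧
      ((γH.1 : GL (Fin 2) K) : Matrix (Fin 2) (Fin 2) K) = a • 1 ∧ ((γH.2 : GL (Fin 1) K) : Matrix (Fin 1) (Fin 1) K) = b • 1 := by
  obtain ⟨γH, h1, h2, hγH⟩ := exists_transfersTo_fst_eq_smul_one σ h γ₀ hab ha hb hγ hchar
  refine ⟨γH, StableClassH.eq_of_transfersTo_of_sndVal_eq hγH ht ?_, h1, h2⟩
  rw [StableClassH.sndVal_stableClassHOf, h2, hsnd, Matrix.smul_apply, Matrix.one_apply_eq, smul_eq_mul, mul_one]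

/-! ### The central class `γ₀ = ζ · 1` -/

/-- **At a CENTRAL `γ₀ = ζ · 1₃` exactly the pairs `γ_H = (ζ · 1₂, ζ)` match** (the `GL₃`-class of a scalar is a singleton, and `ι` is injective on
blocks). [cite: Rogawski1990, §5.4 p. 78; §3.1 p. 19] -/
theorem transfersTo_mk_iff_of_coe_eq_smul_one {γ₀ : unitaryGroup σ H'} {ζ : K} (hζ : ((γ₀ : GL (Fin 3) K) : Matrix (Fin 3) (Fin 3) K) = ζ • 1)
    (γH : unitaryGroup σ J₂ × unitaryGroup σ J₁) :
    (stableClassHOf σ J₂ J₁ γH).TransfersTo H' h (stableClassOf σ H' γ₀) ↔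
      ((γH.1 : GL (Fin 2) K) : Matrix (Fin 2) (Fin 2) K) = ζ • 1 ∧ ((γH.2 : GL (Fin 1) K) : Matrix (Fin 1) (Fin 1) K) = ζ • 1 := by
  rw [StableClassH.transfersTo_mk_iff]
  unfold EndoMatches Corresponds
  rw [coe_endoEmb]
  refine Iff.trans ?_ (endoGL_eq_smul_one_iff ((γH.1 : GL (Fin 2) K), (γH.2 : GL (Fin 1) K)) ζ)
  constructor
  · intro hc
    exact coe_eq_smul_one_of_isConj hc.symm hζ
  · intro hE
    have hEq : (endoGL ((γH.1 : GL (Fin 2) K), (γH.2 : GL (Fin 1) K)) : GL (Fin 3) K) = (γ₀ : GL (Fin 3) K) := Units.ext (by rw [hE, hζ])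
    rw [hEq]

/-- **Existence at a central class**: `[(ζ · 1₂, ζ)] ↦ 𝒪_st(ζ · 1₃)` (`σ(ζ) ζ = 1` holds for `H′ ≠ 0`, ★ `norm_eq_one_of_coe_eq_smul_one`).
[cite: Rogawski1990, §5.4 p. 78] -/
theorem exists_transfersTo_of_coe_eq_smul_one {γ₀ : unitaryGroup σ H'} {ζ : K} (hζ : ((γ₀ : GL (Fin 3) K) : Matrix (Fin 3) (Fin 3) K) = ζ • 1)
    (hn : σ ζ * ζ = 1) :
    ∃ γH : unitaryGroup σ J₂ × unitaryGroup σ J₁,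
      ((γH.1 : GL (Fin 2) K) : Matrix (Fin 2) (Fin 2) K) = ζ • 1 ∧ ((γH.2 : GL (Fin 1) K) : Matrix (Fin 1) (Fin 1) K) = ζ • 1 ∧
        (stableClassHOf σ J₂ J₁ γH).TransfersTo H' h (stableClassOf σ H' γ₀) := by
  obtain ⟨g₂, hg₂⟩ := exists_unitary_coe_eq_smul_one σ J₂ hn
  obtain ⟨u, hu⟩ := exists_unitary_coe_eq_smul_one σ J₁ hn
  exact ⟨(g₂, u), hg₂, hu, (transfersTo_mk_iff_of_coe_eq_smul_one σ h hζ _).mpr ⟨hg₂, hu⟩⟩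

/-- **EXACTLY ONE stable class of `H` transfers to a central class.** [cite: Rogawski1990, §5.4 p. 78] -/
theorem ncard_setOf_transfersTo_eq_one_of_coe_eq_smul_one {γ₀ : unitaryGroup σ H'} {ζ : K}
    (hζ : ((γ₀ : GL (Fin 3) K) : Matrix (Fin 3) (Fin 3) K) = ζ • 1) (hn : σ ζ * ζ = 1) :
    {𝒪 : StableClassH σ J₂ J₁ | 𝒪.TransfersTo H' h (stableClassOf σ H' γ₀)}.ncard = 1 := by
  obtain ⟨γH, h1, h2, hγH⟩ := exists_transfersTo_of_coe_eq_smul_one σ h hζ hn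
  rw [Set.ncard_eq_one]
  refine ⟨stableClassHOf σ J₂ J₁ γH, Set.eq_singleton_iff_unique_mem.mpr ⟨hγH, fun 𝒪 h𝒪 => ?_⟩⟩
  obtain ⟨γH', rfl⟩ := stableClassHOf_surjective 𝒪
  obtain ⟨h1', h2'⟩ := (transfersTo_mk_iff_of_coe_eq_smul_one σ h hζ γH').mp h𝒪
  have heq : γH' = γH := Prod.ext (Subtype.ext (Units.ext (by rw [h1', h1]))) (Subtype.ext (Units.ext (by rw [h2', h2])))
  rw [heq]

/-- Subtype form: `Nat.card {𝒪′ // 𝒪′ ↦ 𝒪_st(ζ · 1)} = 1`. [cite: Rogawski1990, §5.4 p. 78] -/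
theorem natCard_subtype_transfersTo_eq_one_of_coe_eq_smul_one {γ₀ : unitaryGroup σ H'} {ζ : K}
    (hζ : ((γ₀ : GL (Fin 3) K) : Matrix (Fin 3) (Fin 3) K) = ζ • 1) (hn : σ ζ * ζ = 1) :
    Nat.card {𝒪 : StableClassH σ J₂ J₁ // 𝒪.TransfersTo H' h (stableClassOf σ H' γ₀)} = 1 :=
  ncard_setOf_transfersTo_eq_one_of_coe_eq_smul_one σ h hζ hn

end Transfer

/-! ## §4 The split `U(2)`-factor `J₂ = Φ₂`: the element `h₂`, the class `[(h₂, a)]`, and the COUNT `= 2` -/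

section Split

variable {K : Type*} [Field K] (σ : K →+* K) {J₁ : Matrix (Fin 1) (Fin 1) K} {J₃ : Matrix (Fin 3) (Fin 3) K}
  (h : endoForm (Matrix.of fun i j : Fin 2 => if i.val + j.val + 1 = 2 then (1 : K) else 0) J₁ = J₃) {H' : Matrix (Fin 3) (Fin 3) K}

/-- **An element of the quasi-split `U_σ(Φ₂)(K)` with prescribed norm-one eigenvalues `a, b`** (`2 ≠ 0`): `h₂ = ½ (a+b  a−b; a−b  a+b)`
(= `P diag(a, b) P⁻¹` for the orthogonal frame `P = (1 1; 1 −1)` of `Φ₂ = antidiag(1, 1)`), with `charpoly h₂ = (X − a)(X − b)`.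
[cite: Rogawski1990, §3.8 Prop. 3.8.1 p. 27; §3.1 p. 19] -/
theorem exists_unitary_antidiagTwo_charpoly_eq (h2 : (2 : K) ≠ 0) {a b : K} (ha : σ a * a = 1) (hb : σ b * b = 1) :
    ∃ g : unitaryGroup σ (Matrix.of fun i j : Fin 2 => if i.val + j.val + 1 = 2 then (1 : K) else 0),
      ((g : GL (Fin 2) K) : Matrix (Fin 2) (Fin 2) K).charpoly = (X - C a) * (X - C b) := by
  have ha0 : a ≠ 0 := fun h0 => by rw [h0, mul_zero] at ha; exact zero_ne_one ha
  have hb0 : b ≠ 0 := fun h0 => by rw [h0, mul_zero] at hb; exact zero_ne_one hb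
  set M : Matrix (Fin 2) (Fin 2) K := !![(a + b) / 2, (a - b) / 2; (a - b) / 2, (a + b) / 2] with hM
  have hdet : M.det = a * b := by rw [hM, Matrix.det_fin_two_of]; field_simp; ring
  have htr : M.trace = a + b := by rw [hM, Matrix.trace_fin_two_of]; field_simp; ring
  have hchar : M.charpoly = (X - C a) * (X - C b) := by
    rw [Matrix.charpoly_fin_two, hdet, htr, map_add, map_mul]; ring
  have hu : IsUnit M := (Matrix.isUnit_iff_isUnit_det M).mpr (by rw [hdet]; exact isUnit_iff_ne_zero.mpr (mul_ne_zero ha0 hb0))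
  have hmem : hu.unit ∈ unitaryGroup σ (Matrix.of fun i j : Fin 2 => if i.val + j.val + 1 = 2 then (1 : K) else 0) := by
    rw [Literature.AlgebraicGeometry.ShimuraVarieties.mem_unitaryGroup_iff, hu.unit_spec, hM]
    have h2σ : σ 2 = 2 := map_ofNat σ 2
    ext i j
    fin_cases i <;> fin_cases j <;>
      · simp [Matrix.mul_apply, Fin.sum_univ_two, map_div₀, h2σ]
        field_simp
        first
          | linear_combination (2 : K) * ha - 2 * hb
          | linear_combination (2 : K) * ha + 2 * hb
  refine ⟨⟨hu.unit, hmem⟩, ?_⟩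
  change (hu.unit : Matrix (Fin 2) (Fin 2) K).charpoly = _
  rw [hu.unit_spec, hchar]

/-- **Existence, the class `[(h₂, a)]`** (`J₂ = Φ₂`, `2 ≠ 0`). [cite: Rogawski1990, §5.4 p. 78] -/
theorem exists_transfersTo_sndVal_eq_double (h2 : (2 : K) ≠ 0) (γ₀ : unitaryGroup σ H') {a b : K} (hab : a ≠ b) (ha : σ a * a = 1)
    (hb : σ b * b = 1)
    (hγ : (((γ₀ : GL (Fin 3) K) : Matrix (Fin 3) (Fin 3) K) - a • 1) * (((γ₀ : GL (Fin 3) K) : Matrix (Fin 3) (Fin 3) K) - b • 1) = 0)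
    (hchar : ((γ₀ : GL (Fin 3) K) : Matrix (Fin 3) (Fin 3) K).charpoly = (X - C a) ^ 2 * (X - C b)) :
    ∃ γH : unitaryGroup σ (Matrix.of fun i j : Fin 2 => if i.val + j.val + 1 = 2 then (1 : K) else 0) × unitaryGroup σ J₁,
      ((γH.1 : GL (Fin 2) K) : Matrix (Fin 2) (Fin 2) K).charpoly = (X - C a) * (X - C b) ∧
        ((γH.2 : GL (Fin 1) K) : Matrix (Fin 1) (Fin 1) K) = a • 1 ∧
          (stableClassHOf σ _ J₁ γH).TransfersTo H' h (stableClassOf σ H' γ₀) := by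
  obtain ⟨g₂, hg₂⟩ := exists_unitary_antidiagTwo_charpoly_eq σ h2 ha hb
  obtain ⟨u, hu⟩ := exists_unitary_coe_eq_smul_one σ J₁ ha
  exact ⟨(g₂, u), hg₂, hu, transfersTo_mk_of_charpoly_fst_eq σ h hab hγ hchar _ hg₂ hu⟩

/-- **Exhaustion, part 3′: a transferring class with `sndVal = a` IS `[(h₂, a)]`.** [cite: Rogawski1990, §5.4 p. 78] -/
theorem StableClassH.TransfersTo.exists_rep_sndVal_eq_double [Infinite K] (h2 : (2 : K) ≠ 0) {γ₀ : unitaryGroup σ H'} {a b : K} (hab : a ≠ b)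
    (ha : σ a * a = 1) (hb : σ b * b = 1)
    (hγ : (((γ₀ : GL (Fin 3) K) : Matrix (Fin 3) (Fin 3) K) - a • 1) * (((γ₀ : GL (Fin 3) K) : Matrix (Fin 3) (Fin 3) K) - b • 1) = 0)
    (hchar : ((γ₀ : GL (Fin 3) K) : Matrix (Fin 3) (Fin 3) K).charpoly = (X - C a) ^ 2 * (X - C b))
    {𝒪 : StableClassH σ (Matrix.of fun i j : Fin 2 => if i.val + j.val + 1 = 2 then (1 : K) else 0) J₁}
    (ht : 𝒪.TransfersTo H' h (stableClassOf σ H' γ₀)) (hsnd : 𝒪.sndVal = a) :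
    ∃ γH : unitaryGroup σ (Matrix.of fun i j : Fin 2 => if i.val + j.val + 1 = 2 then (1 : K) else 0) × unitaryGroup σ J₁,
      stableClassHOf σ _ J₁ γH = 𝒪 ∧ ((γH.1 : GL (Fin 2) K) : Matrix (Fin 2) (Fin 2) K).charpoly = (X - C a) * (X - C b) ∧
        ((γH.2 : GL (Fin 1) K) : Matrix (Fin 1) (Fin 1) K) = a • 1 := by
  obtain ⟨γH, h1, h2', hγH⟩ := exists_transfersTo_sndVal_eq_double σ h h2 γ₀ hab ha hb hγ hchar
  refine ⟨γH, StableClassH.eq_of_transfersTo_of_sndVal_eq hγH ht ?_, h1, h2'⟩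
  rw [StableClassH.sndVal_stableClassHOf, h2', hsnd, Matrix.smul_apply, Matrix.one_apply_eq, smul_eq_mul, mul_one]

/-- **EXACTLY TWO stable classes of `H = U(Φ₂) × U(J₁)` transfer to a singular non-central class `{a, a, b}`** — `[(a · 1₂, b)]` and `[(h₂, a)]`:
the `U(1)`-component is `a` or `b`, it determines the class (★ `injOn_sndVal_setOf_transfersTo`), and both values occur.
[cite: Rogawski1990, §5.4 p. 78] -/
theorem ncard_setOf_transfersTo_eq_two [Infinite K] (h2 : (2 : K) ≠ 0) (γ₀ : unitaryGroup σ H') {a b : K} (hab : a ≠ b)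
    (ha : σ a * a = 1) (hb : σ b * b = 1)
    (hγ : (((γ₀ : GL (Fin 3) K) : Matrix (Fin 3) (Fin 3) K) - a • 1) * (((γ₀ : GL (Fin 3) K) : Matrix (Fin 3) (Fin 3) K) - b • 1) = 0)
    (hchar : ((γ₀ : GL (Fin 3) K) : Matrix (Fin 3) (Fin 3) K).charpoly = (X - C a) ^ 2 * (X - C b)) :
    {𝒪 : StableClassH σ (Matrix.of fun i j : Fin 2 => if i.val + j.val + 1 = 2 then (1 : K) else 0) J₁ |
      𝒪.TransfersTo H' h (stableClassOf σ H' γ₀)}.ncard = 2 := by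
  have himage : StableClassH.sndVal '' {𝒪 : StableClassH σ (Matrix.of fun i j : Fin 2 => if i.val + j.val + 1 = 2 then (1 : K) else 0) J₁ |
      𝒪.TransfersTo H' h (stableClassOf σ H' γ₀)} = {a, b} := by
    apply Set.Subset.antisymm
    · rintro _ ⟨𝒪, h𝒪, rfl⟩
      rcases StableClassH.TransfersTo.sndVal_eq_or_eq σ h hchar h𝒪 with h' | h'
      · exact h' ▸ Set.mem_insert _ _
      · exact h' ▸ Set.mem_insert_of_mem _ (Set.mem_singleton _)
    · rintro x (rfl | rfl)
      · obtain ⟨γH, -, h2', hγH⟩ := exists_transfersTo_sndVal_eq_double σ h h2 γ₀ hab ha hb hγ hchar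
        refine ⟨stableClassHOf σ _ J₁ γH, hγH, ?_⟩
        rw [StableClassH.sndVal_stableClassHOf, h2', Matrix.smul_apply, Matrix.one_apply_eq, smul_eq_mul, mul_one]
      · obtain ⟨γH, -, h2', hγH⟩ := exists_transfersTo_fst_eq_smul_one σ h γ₀ hab ha hb hγ hchar
        refine ⟨stableClassHOf σ _ J₁ γH, hγH, ?_⟩
        rw [StableClassH.sndVal_stableClassHOf, h2', Matrix.smul_apply, Matrix.one_apply_eq, smul_eq_mul, mul_one]
  rw [← (StableClassH.injOn_sndVal_setOf_transfersTo h (stableClassOf σ H' γ₀)).ncard_image, himage, Set.ncard_pair hab]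

/-- Subtype form: `Nat.card {𝒪′ // 𝒪′ ↦ 𝒪_st(γ₀)} = 2` at a singular non-central `γ₀`. [cite: Rogawski1990, §5.4 p. 78] -/
theorem natCard_subtype_transfersTo_eq_two [Infinite K] (h2 : (2 : K) ≠ 0) (γ₀ : unitaryGroup σ H') {a b : K} (hab : a ≠ b)
    (ha : σ a * a = 1) (hb : σ b * b = 1)
    (hγ : (((γ₀ : GL (Fin 3) K) : Matrix (Fin 3) (Fin 3) K) - a • 1) * (((γ₀ : GL (Fin 3) K) : Matrix (Fin 3) (Fin 3) K) - b • 1) = 0)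
    (hchar : ((γ₀ : GL (Fin 3) K) : Matrix (Fin 3) (Fin 3) K).charpoly = (X - C a) ^ 2 * (X - C b)) :
    Nat.card {𝒪 : StableClassH σ (Matrix.of fun i j : Fin 2 => if i.val + j.val + 1 = 2 then (1 : K) else 0) J₁ //
      𝒪.TransfersTo H' h (stableClassOf σ H' γ₀)} = 2 :=
  ncard_setOf_transfersTo_eq_two σ h h2 γ₀ hab ha hb hγ hchar

/-- **The structure theorem** (iff form): `𝒪′_H ↦ 𝒪_st(γ₀)` iff `𝒪′_H = [(a · 1₂, b)]` or `𝒪′_H = [(h₂, a)]` with `charpoly h₂ = (X − a)(X − b)`.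
[cite: Rogawski1990, §5.4 p. 78] -/
theorem transfersTo_iff_exists_rep [Infinite K] (h2 : (2 : K) ≠ 0) (γ₀ : unitaryGroup σ H') {a b : K} (hab : a ≠ b)
    (ha : σ a * a = 1) (hb : σ b * b = 1)
    (hγ : (((γ₀ : GL (Fin 3) K) : Matrix (Fin 3) (Fin 3) K) - a • 1) * (((γ₀ : GL (Fin 3) K) : Matrix (Fin 3) (Fin 3) K) - b • 1) = 0)
    (hchar : ((γ₀ : GL (Fin 3) K) : Matrix (Fin 3) (Fin 3) K).charpoly = (X - C a) ^ 2 * (X - C b))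
    (𝒪 : StableClassH σ (Matrix.of fun i j : Fin 2 => if i.val + j.val + 1 = 2 then (1 : K) else 0) J₁) :
    𝒪.TransfersTo H' h (stableClassOf σ H' γ₀) ↔
      ∃ γH : unitaryGroup σ (Matrix.of fun i j : Fin 2 => if i.val + j.val + 1 = 2 then (1 : K) else 0) × unitaryGroup σ J₁,
        stableClassHOf σ _ J₁ γH = 𝒪 ∧
          ((((γH.1 : GL (Fin 2) K) : Matrix (Fin 2) (Fin 2) K) = a • 1 ∧ ((γH.2 : GL (Fin 1) K) : Matrix (Fin 1) (Fin 1) K) = b • 1) ∨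
            (((γH.1 : GL (Fin 2) K) : Matrix (Fin 2) (Fin 2) K).charpoly = (X - C a) * (X - C b) ∧
              ((γH.2 : GL (Fin 1) K) : Matrix (Fin 1) (Fin 1) K) = a • 1)) := by
  constructor
  · intro ht
    rcases StableClassH.TransfersTo.sndVal_eq_or_eq σ h hchar ht with hs | hs
    · obtain ⟨γH, h𝒪, h1, h2'⟩ := StableClassH.TransfersTo.exists_rep_sndVal_eq_double σ h h2 hab ha hb hγ hchar ht hs
      exact ⟨γH, h𝒪, Or.inr ⟨h1, h2'⟩⟩
    · obtain ⟨γH, h𝒪, h1, h2'⟩ := StableClassH.TransfersTo.exists_rep_fst_eq_smul_one σ h hab ha hb hγ hchar ht hs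
      exact ⟨γH, h𝒪, Or.inl ⟨h1, h2'⟩⟩
  · rintro ⟨γH, rfl, ⟨h1, h2'⟩ | ⟨h1, h2'⟩⟩
    · exact transfersTo_mk_of_fst_eq_smul_one σ h hab hγ hchar γH h1 h2'
    · exact transfersTo_mk_of_charpoly_fst_eq σ h hab hγ hchar γH h1 h2'

end Split

/-! ## §5 CM reading: `L` CM, `σ = c`, `H = U(Φ₂) × U(Φ₁) → U(Φ₃) ⊃` classes of the inner form `U(H′)` -/

section CM

open NumberField
open Literature.NumberTheory.Automorphic (cmConjRingHom)

variable (L : Type) [Field L] [NumberField L] [IsCMField L]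

/-- **(S-br) at the CM pair**: a semisimple NON-REGULAR `γ ∈ U(H′)(L⁺)` (`H′ ∈ M₃(L)` hermitian non-degenerate) has `a ≠ b ∈ L` of norm one with
`(γ − a)(γ − b) = 0`. [cite: Rogawski1990, §3.8 Prop. 3.8.1 (a) p. 27] -/
theorem exists_ne_mul_sub_eq_zero_of_isSemisimpleElt_of_not_isRegularElt_cm {H' : Matrix (Fin 3) (Fin 3) L}
    (hH : (H'.map (cmConjRingHom L))ᵀ = H') (hHd : H'.det ≠ 0) (γ : unitaryGroup (cmConjRingHom L) H')
    (hss : IsSemisimpleElt (cmConjRingHom L) H' γ) (hnreg : ¬ IsRegularElt (γ : GL (Fin 3) L)) :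
    ∃ a b : L, a ≠ b ∧ cmConjRingHom L a * a = 1 ∧ cmConjRingHom L b * b = 1 ∧
      (((γ : GL (Fin 3) L) : Matrix (Fin 3) (Fin 3) L) - a • 1) * (((γ : GL (Fin 3) L) : Matrix (Fin 3) (Fin 3) L) - b • 1) = 0 :=
  exists_ne_mul_sub_eq_zero_of_isSemisimpleElt_of_not_isRegularElt (cmConjRingHom L) (IsCMField.complexConj_apply_apply L) two_ne_zero hH hHd γ
    hss hnreg

/-- **(T-s) at the CM pair, singular non-central `γ₀`: EXACTLY TWO stable classes of `H(L⁺) = U(Φ₂)(L⁺) × U(Φ₁)(L⁺)` transfer to `𝒪_st(γ₀)`.**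
[cite: Rogawski1990, §5.4 p. 78] -/
theorem natCard_subtype_transfersTo_antidiagOne_eq_two {H' : Matrix (Fin 3) (Fin 3) L} (γ₀ : unitaryGroup (cmConjRingHom L) H') {a b : L}
    (hab : a ≠ b) (ha : cmConjRingHom L a * a = 1) (hb : cmConjRingHom L b * b = 1)
    (hγ : (((γ₀ : GL (Fin 3) L) : Matrix (Fin 3) (Fin 3) L) - a • 1) * (((γ₀ : GL (Fin 3) L) : Matrix (Fin 3) (Fin 3) L) - b • 1) = 0)
    (hchar : ((γ₀ : GL (Fin 3) L) : Matrix (Fin 3) (Fin 3) L).charpoly = (X - C a) ^ 2 * (X - C b)) :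
    Nat.card {𝒪 : StableClassH (cmConjRingHom L) (Matrix.of fun i j : Fin 2 => if i.val + j.val + 1 = 2 then (1 : L) else 0)
      (Matrix.of fun i j : Fin 1 => if i.val + j.val + 1 = 1 then (1 : L) else 0) // 𝒪.TransfersTo H' endoForm_antidiagOne (stableClassOf _ H' γ₀)} = 2 :=
  natCard_subtype_transfersTo_eq_two (cmConjRingHom L) endoForm_antidiagOne two_ne_zero γ₀ hab ha hb hγ hchar

/-- **(T-s) at the CM pair, central `γ₀ = ζ · 1`: EXACTLY ONE stable class of `H(L⁺)` transfers to `𝒪_st(γ₀)`** (`H′ ∈ M₃(L)` with `det H′ ≠ 0`).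
[cite: Rogawski1990, §5.4 p. 78] -/
theorem natCard_subtype_transfersTo_antidiagOne_eq_one_of_coe_eq_smul_one {H' : Matrix (Fin 3) (Fin 3) L} (hHd : H'.det ≠ 0)
    (γ₀ : unitaryGroup (cmConjRingHom L) H') {ζ : L} (hζ : ((γ₀ : GL (Fin 3) L) : Matrix (Fin 3) (Fin 3) L) = ζ • 1) :
    Nat.card {𝒪 : StableClassH (cmConjRingHom L) (Matrix.of fun i j : Fin 2 => if i.val + j.val + 1 = 2 then (1 : L) else 0)
      (Matrix.of fun i j : Fin 1 => if i.val + j.val + 1 = 1 then (1 : L) else 0) // 𝒪.TransfersTo H' endoForm_antidiagOne (stableClassOf _ H' γ₀)} = 1 :=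
  natCard_subtype_transfersTo_eq_one_of_coe_eq_smul_one (cmConjRingHom L) endoForm_antidiagOne hζ
    (norm_eq_one_of_coe_eq_smul_one (cmConjRingHom L) (ne_zero_of_det_ne_zero hHd) γ₀ hζ)

end CM

end Literature.NumberTheory.Rogawski1990

end
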